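import Literature.MathematicalPhysics.QuantumFieldTheory.Balaban1983to89.Node00.MultiScaleFibreChart

/-!
# NODE 00 — THE CANONICAL MULTI-SCALE CHART IN LOCAL-SMOOTHNESS CURRENCY: `IsFibreChartNear` and the tangent form (82) on a multi-scale fibre modulo [15] (45) at `U`,
# asking only that the finitely many CONSTRAINED outputs `X ↦ Ū^j(U·exp X)(c)` be `C¹` at `X = 0` (no global small-field guard) — the form a TOP-DOMAIN consumer can meet

Cell `pub-ymgap`, width seat `pub-ymgap-dag-n07-w2` generation 0 (HUMAN RULING D-0149; R141 (C) lane of DAG node N07 = [15] = [Balaban1985Variational]; plan g77∕g78 W-SEAT START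
LIST §n07 sub-target S2; INBOX INTENT-2 of 2026-08-27 ≈23:27Z).  NEW leaf importing this seat's `Node00.MultiScaleFibreChart` (p584862: `suProj`, `rhoSU`, `msChart`, `relAvg`,
`constrEnum`, `eq_one_of_suProj_mlog_eq_zero`, `msChart_zero_of_agreeOn`, `avg_eq_of_relAvg_eq_one`, `relAvg_mem_SU`, `eventually_smallBelow_expChart`, …) and, through it, n07-e's 35a∕35b-i;
nothing modified.  `--kind proof --supports stmt-QuantumFields-20542` (K1⁷; count-neutral; theorems only).

WHY.  File 1 (`MultiScaleFibreChart`) proves 35a's `IsFibreChartNear` for the canonical chart and the multi-scale tangent form under the GLOBAL guard `SmallBelow (avOfRecord F N K) k U`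
(the iterated averages of `U` on the small-field domain of (0.4) at EVERY coarse bond of the torus — the currency of 35b-i∕35c and of the K1 road, whose class (2) is on `Ω₀ = T`).  Stub 1's
TOP-DOMAIN reading (`Prop8RegSepTopStep … Sup`: [15] (6) with the scale-0 members on `Ω₀ = Sup ν K s.Ω`) controls the field only on the top domain; outside it the data of the level-0 pin may be
large, so the global guard is not available there.  But the chart reads ONLY the finitely many constrained outputs `Ū^j(U·exp X)(c)`, `(j, c)` a bond meeting `Γ_j`, `j ≤ k`, whose supports
lie in the blocks around `Γ_j ⊂ Ω_j`.  THIS FILE therefore re-derives §4–§6 of file 1 from the minimal local hypothesis: each constrained output is `C¹` at `X = 0` as a function of the chart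
variable (`hsm`).  File 1's global guard is ONE sufficient condition (`contDiffAt_coe_avgFamily_expChart_of_smallBelow`); a support-localised guard (the (0.4) average at `c` reads the two blocks of
`c` only, `Averaging.local_dep`) is the consumer's other road.  Everything else — the level set from `e^{log g} = g`, the derivative in velocity currency, surjectivity from (45) at `U` — is as in
file 1.

CONTENTS.  `contDiffAt_coe_avgFamily_expChart_of_smallBelow` (global guard ⇒ local smoothness), ★ `contDiffAt_msChart_of_smooth`, `hasStrictFDerivAt_msChart_of_smooth`,
★★ `fderiv_msChart_apply_of_hasDerivAt_of_smooth`, ★ `eventually_agreeOn_of_msChart_eq_of_smooth`, ★★ `isFibreChartNear_msChart_of_smooth`,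
★★★ `hasDerivAt_wilsonAction4_expChart_of_isCritOnFibre_of_smooth_of_rightInverse`.

HONEST FRAMING: kernel calculus; no definition; the right inverse (45) at `U` (`hH`) and the local smoothness (`hsm`) are DISPLAYED HYPOTHESES; nothing of [15] asserted; stub 1 ∕ K0⁷ NOT
closed; N07 NOT discharged; counts unmoved (5∕27); one finite T⁴ programme at fixed ε — NOT continuum ∕ ℝ⁴ ∕ OS ∕ mass gap ∕ Clay (R4 closes the conditional rung `BalabanLadder.UV` only).
No `sorry`, no `axiom`, no `instance`, no `notation`.
-/

noncomputable section

namespace Literature.MathematicalPhysics.QuantumFieldTheory.Balaban1983to89.Node00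

open Filter Topology
open T4Continuum (T4Family)
open B15DeterminingSets
open BlockAveraging (blockAvg Small)
open ExpMeanLog (expMeanLogSU)
open MatrixLog (mlog mlog_one exp_mlog analyticAt_mlog)
open T4AdjointCovarianceUnitary (lieSU expSU coe_expSU mem_lieSU_iff)
open scoped Matrix.Norms.L2Operator

/-! ## §1  Local smoothness from the global guard; the chart, its derivative, its level set and the tangent form in local-smoothness currency -/

section Local

variable {F : T4Family} {N : ℕ} [NeZero N]
variable {K k : ℕ} {𝔹 : DetSet (F.P K)} {W : MSField (F.P K) (SU N)} {U : GaugeField (F.P K) 0 (SU N)}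

/-- **The global guard is ONE sufficient condition for local smoothness of the constrained outputs**: under `SmallBelow … k U` every output
`X ↦ Ū^j(U·exp X)(c)`, `j ≤ k`, is `C¹` at `X = 0` (it agrees near `0` with the `C^∞` matrix extension). [cite: Balaban1987RG1, (0.4) p.253, (0.21) p.256] -/
theorem contDiffAt_coe_avgFamily_expChart_of_smallBelow (hsb : SmallBelow (avOfRecord F N K) k U) {j : ℕ} (hj : j ≤ k) (c : PBond (F.P K) j) :
    ContDiffAt ℝ 1 (fun X : PBond (F.P K) 0 → lieSU (Fin N) =>
      ((avgFamily (avOfRecord F N K) (expChart U X) j c : SU N) : Matrix (Fin N) (Fin N) ℂ)) 0 := by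
  have hsbN : ∀ᶠ X in 𝓝 (0 : PBond (F.P K) 0 → lieSU (Fin N)), SmallBelow (avOfRecord F N K) k (expChart U X) :=
    eventually_smallBelow_expChart (P := F.P K) hsb
  have h1 : ContDiffAt ℝ ⊤ (fun X : PBond (F.P K) 0 → lieSU (Fin N) => iterM j (coeField (expChart U X)) c) 0 :=
    (contDiffAt_pi.1 (contDiffAt_iterM_expChart (P := F.P K) (hsb.mono hj))) c
  refine (h1.of_le le_top).congr_of_eventuallyEq (hsbN.mono fun X hX => ?_)
  show ((avgFamily (avOfRecord F N K) (expChart U X) j c : SU N) : Matrix (Fin N) (Fin N) ℂ) = iterM j (coeField (expChart U X)) c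
  rw [← coeField_avgFamily_eq_iterM (hX.mono hj)]
  rfl

/-- ★ **THE CHART IS `C¹` AT `0` FROM LOCAL SMOOTHNESS OF THE CONSTRAINED OUTPUTS** (`U` in the fibre; each constrained output `C¹` at `X = 0`): composition with the left
multiplication by `W_j(c)*`, `log` (analytic at `W*W = 1`) and `π`. [cite: Balaban1985Variational, Sect. C p.285, (82)–(83) p.290; Balaban1985Averaging, (21) p.21] -/
theorem contDiffAt_msChart_of_smooth (hU : AgreeOn 𝔹 (avgFamily (avOfRecord F N K) U) W)
    (hsm : ∀ j, j ≤ k → ∀ c ∈ bondsOf (𝔹 j), ContDiffAt ℝ 1 (fun X : PBond (F.P K) 0 → lieSU (Fin N) =>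
      ((avgFamily (avOfRecord F N K) (expChart U X) j c : SU N) : Matrix (Fin N) (Fin N) ℂ)) 0) :
    ContDiffAt ℝ 1 (msChart F N K k 𝔹 W U) 0 := by
  refine contDiffAt_pi.2 fun i => ?_
  set s := (constrEnum 𝔹 k).symm i with hs
  have hj : (s.1 : ℕ) ≤ k := Nat.lt_succ_iff.1 s.1.2
  have hin : ContDiffAt ℝ 1 (fun X : PBond (F.P K) 0 → lieSU (Fin N) => relAvg K W (expChart U X) s.1 s.2.1) 0 :=
    contDiffAt_const.mul (hsm s.1 hj s.2.1 s.2.2)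
  have h0 : relAvg K W (expChart U (0 : PBond (F.P K) 0 → lieSU (Fin N))) s.1 s.2.1 = 1 := by
    rw [expChart_zero]; exact relAvg_eq_one_of_agreeOn hU s.2.2
  have hlog : ContDiffAt ℝ 1 (mlog : Matrix (Fin N) (Fin N) ℂ → Matrix (Fin N) (Fin N) ℂ)
      (relAvg K W (expChart U (0 : PBond (F.P K) 0 → lieSU (Fin N))) s.1 s.2.1) := by
    rw [h0]
    exact (((analyticAt_mlog (by simp)).contDiffAt).restrict_scalars ℝ).of_le le_top
  have hcomp : ContDiffAt ℝ 1 (fun X : PBond (F.P K) 0 → lieSU (Fin N) => mlog (relAvg K W (expChart U X) s.1 s.2.1)) 0 :=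
    ContDiffAt.comp (g := (mlog : Matrix (Fin N) (Fin N) ℂ → Matrix (Fin N) (Fin N) ℂ))
      (f := fun X : PBond (F.P K) 0 → lieSU (Fin N) => relAvg K W (expChart U X) s.1 s.2.1) 0 hlog hin
  exact ((suProj N).contDiff.of_le le_top).contDiffAt.comp 0 hcomp

/-- Strict differentiability at `0` in the local-smoothness currency. [cite: Balaban1985Variational, (82)–(83) p.290] -/
theorem hasStrictFDerivAt_msChart_of_smooth (hU : AgreeOn 𝔹 (avgFamily (avOfRecord F N K) U) W)
    (hsm : ∀ j, j ≤ k → ∀ c ∈ bondsOf (𝔹 j), ContDiffAt ℝ 1 (fun X : PBond (F.P K) 0 → lieSU (Fin N) =>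
      ((avgFamily (avOfRecord F N K) (expChart U X) j c : SU N) : Matrix (Fin N) (Fin N) ℂ)) 0) :
    HasStrictFDerivAt (msChart F N K k 𝔹 W U) (fderiv ℝ (msChart F N K k 𝔹 W U) 0) 0 :=
  (contDiffAt_msChart_of_smooth hU hsm).hasStrictFDerivAt one_ne_zero

/-- ★★ The derivative of the chart in velocity currency, local-smoothness version: `(Φ′X)_i = π(W* · v)`. [cite: Balaban1985Variational, Sect. C (44)–(48) p.285, (83) p.290] -/
theorem fderiv_msChart_apply_of_hasDerivAt_of_smooth (hU : AgreeOn 𝔹 (avgFamily (avOfRecord F N K) U) W)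
    (hsm : ∀ j, j ≤ k → ∀ c ∈ bondsOf (𝔹 j), ContDiffAt ℝ 1 (fun X : PBond (F.P K) 0 → lieSU (Fin N) =>
      ((avgFamily (avOfRecord F N K) (expChart U X) j c : SU N) : Matrix (Fin N) (Fin N) ℂ)) 0)
    (X : PBond (F.P K) 0 → lieSU (Fin N)) (i : Fin (constrCard 𝔹 k)) {v : Matrix (Fin N) (Fin N) ℂ}
    (hv : HasDerivAt (fun t : ℝ => ((avgFamily (avOfRecord F N K) (expChart U (t • X)) ((constrEnum 𝔹 k).symm i).1 ((constrEnum 𝔹 k).symm i).2.1 : SU N) :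
      Matrix (Fin N) (Fin N) ℂ)) v 0) :
    fderiv ℝ (msChart F N K k 𝔹 W U) 0 X i = suProj N (star ((W ((constrEnum 𝔹 k).symm i).1 ((constrEnum 𝔹 k).symm i).2.1 : SU N) : Matrix (Fin N) (Fin N) ℂ) * v) := by
  set s := (constrEnum 𝔹 k).symm i with hs
  set Ws : Matrix (Fin N) (Fin N) ℂ := star ((W s.1 s.2.1 : SU N) : Matrix (Fin N) (Fin N) ℂ) with hWs
  have hray : HasDerivAt (fun t : ℝ => msChart F N K k 𝔹 W U (t • X)) (fderiv ℝ (msChart F N K k 𝔹 W U) 0 X) 0 :=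
    (hasStrictFDerivAt_msChart_of_smooth hU hsm).hasFDerivAt.comp_hasDerivAt_of_eq (0 : ℝ) (hasDerivAt_ray X) (zero_smul ℝ X).symm
  have hrayi : HasDerivAt (fun t : ℝ => msChart F N K k 𝔹 W U (t • X) i) (fderiv ℝ (msChart F N K k 𝔹 W U) 0 X i) 0 := (hasDerivAt_pi.1 hray) i
  have hg : HasDerivAt (fun t : ℝ => Ws * ((avgFamily (avOfRecord F N K) (expChart U (t • X)) s.1 s.2.1 : SU N) : Matrix (Fin N) (Fin N) ℂ)) (Ws * v) 0 :=
    hv.const_mul Ws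
  have hg0 : Ws * ((avgFamily (avOfRecord F N K) (expChart U ((0 : ℝ) • X)) s.1 s.2.1 : SU N) : Matrix (Fin N) (Fin N) ℂ) = 1 := by
    rw [zero_smul, expChart_zero]
    exact relAvg_eq_one_of_agreeOn hU s.2.2
  have hlog : HasDerivAt (fun t : ℝ => mlog (Ws * ((avgFamily (avOfRecord F N K) (expChart U (t • X)) s.1 s.2.1 : SU N) : Matrix (Fin N) (Fin N) ℂ))) (Ws * v) 0 := by
    have hD : HasFDerivAt (mlog : Matrix (Fin N) (Fin N) ℂ → Matrix (Fin N) (Fin N) ℂ)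
        (((1 : Matrix (Fin N) (Fin N) ℂ →L[ℂ] Matrix (Fin N) (Fin N) ℂ)).restrictScalars ℝ)
        (Ws * ((avgFamily (avOfRecord F N K) (expChart U ((0 : ℝ) • X)) s.1 s.2.1 : SU N) : Matrix (Fin N) (Fin N) ℂ)) := by
      rw [hg0]
      exact (B7TransferAnalyticMean.hasFDerivAt_mlog_one).restrictScalars ℝ
    have h := hD.comp_hasDerivAt (0 : ℝ) hg
    rw [ContinuousLinearMap.coe_restrictScalars', one_apply_eq_self] at h
    exact h
  have hdirect : HasDerivAt (fun t : ℝ => msChart F N K k 𝔹 W U (t • X) i) (suProj N (Ws * v)) 0 :=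
    (suProj N).hasFDerivAt.comp_hasDerivAt (0 : ℝ) hlog
  exact hrayi.unique hdirect

/-- ★ The level set of the chart through `0` lies in the fibre, near `0` — local-smoothness version (continuity of each constrained relative average at `0`).
[cite: Balaban1985Variational, (3) p.278, (82)–(83) p.290; Balaban1988Convergent, (2.10) p.256] -/
theorem eventually_agreeOn_of_msChart_eq_of_smooth (h𝔹 : ∀ j, k < j → 𝔹 j = ∅) (hU : AgreeOn 𝔹 (avgFamily (avOfRecord F N K) U) W)
    (hsm : ∀ j, j ≤ k → ∀ c ∈ bondsOf (𝔹 j), ContDiffAt ℝ 1 (fun X : PBond (F.P K) 0 → lieSU (Fin N) =>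
      ((avgFamily (avOfRecord F N K) (expChart U X) j c : SU N) : Matrix (Fin N) (Fin N) ℂ)) 0) :
    ∀ᶠ X in 𝓝 (0 : PBond (F.P K) 0 → lieSU (Fin N)),
      msChart F N K k 𝔹 W U X = msChart F N K k 𝔹 W U 0 → AgreeOn 𝔹 (avgFamily (avOfRecord F N K) (expChart U X)) W := by
  have hnear : ∀ᶠ X in 𝓝 (0 : PBond (F.P K) 0 → lieSU (Fin N)), ∀ i : Fin (constrCard 𝔹 k),
      ‖relAvg K W (expChart U X) ((constrEnum 𝔹 k).symm i).1 ((constrEnum 𝔹 k).symm i).2.1 - 1‖ ≤ rhoSU N := by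
    refine eventually_all.2 fun i => ?_
    set s := (constrEnum 𝔹 k).symm i with hs
    have hj : (s.1 : ℕ) ≤ k := Nat.lt_succ_iff.1 s.1.2
    have hcont : ContinuousAt (fun X : PBond (F.P K) 0 → lieSU (Fin N) => relAvg K W (expChart U X) s.1 s.2.1) 0 :=
      (contDiffAt_const.mul (hsm s.1 hj s.2.1 s.2.2)).continuousAt
    have h0 : relAvg K W (expChart U (0 : PBond (F.P K) 0 → lieSU (Fin N))) s.1 s.2.1 = 1 := by
      rw [expChart_zero]; exact relAvg_eq_one_of_agreeOn hU s.2.2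
    have ht : Tendsto (fun X : PBond (F.P K) 0 → lieSU (Fin N) => relAvg K W (expChart U X) s.1 s.2.1) (𝓝 0) (𝓝 1) := by
      rw [← h0]; exact hcont.tendsto
    exact ((Metric.tendsto_nhds.1 ht) (rhoSU N) rhoSU_pos).mono fun X hX => by rw [dist_eq_norm] at hX; exact hX.le
  refine hnear.mono fun X hX hΦ j c hc => ?_
  by_cases hj : j ≤ k
  · set s : ConstrSet 𝔹 k := ⟨⟨j, Nat.lt_succ_of_le hj⟩, c, hc⟩ with hs
    have hi := congrFun hΦ (constrEnum 𝔹 k s)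
    rw [msChart_zero_of_agreeOn hU] at hi
    rw [msChart_apply, Equiv.symm_apply_apply] at hi
    have hρ := hX (constrEnum 𝔹 k s)
    rw [Equiv.symm_apply_apply] at hρ
    exact avg_eq_of_relAvg_eq_one (eq_one_of_suProj_mlog_eq_zero (relAvg_mem_SU _ _ _) hρ hi)
  · exfalso
    have he : 𝔹 j = ∅ := h𝔹 j (lt_of_not_ge hj)
    rw [he] at hc
    simp [bondsOf] at hc

/-- ★★ **`IsFibreChartNear` IN THE LOCAL-SMOOTHNESS CURRENCY**: `𝐁` level-bounded, `U` in the fibre, each constrained output `C¹` at `X = 0`, and (45) at `U` in velocity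
currency ⇒ the canonical chart is a submersive chart of the constraint near `U`.  (The global guard `SmallBelow` of §6 is one way to get the smoothness clause; on a TOP
DOMAIN only the supports of the constrained outputs need the guard.) [cite: Balaban1985Variational, (45)–(48) p.285, Prop. 3 p.289, (82)–(83) p.290; Balaban1988Convergent, (2.10)–(2.12) p.256] -/
theorem isFibreChartNear_msChart_of_smooth (h𝔹 : ∀ j, k < j → 𝔹 j = ∅) (hU : AgreeOn 𝔹 (avgFamily (avOfRecord F N K) U) W)
    (hsm : ∀ j, j ≤ k → ∀ c ∈ bondsOf (𝔹 j), ContDiffAt ℝ 1 (fun X : PBond (F.P K) 0 → lieSU (Fin N) =>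
      ((avgFamily (avOfRecord F N K) (expChart U X) j c : SU N) : Matrix (Fin N) (Fin N) ℂ)) 0)
    (hH : ∀ τ : (j : ℕ) → PBond (F.P K) j → lieSU (Fin N), ∃ X : PBond (F.P K) 0 → lieSU (Fin N), ∀ j, j ≤ k → ∀ c ∈ bondsOf (𝔹 j),
      HasDerivAt (fun t : ℝ => ((avgFamily (avOfRecord F N K) (expChart U (t • X)) j c : SU N) : Matrix (Fin N) (Fin N) ℂ))
        (((W j c : SU N) : Matrix (Fin N) (Fin N) ℂ) * ((τ j c : lieSU (Fin N)) : Matrix (Fin N) (Fin N) ℂ)) 0) :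
    IsFibreChartNear F N K 𝔹 W U (msChart F N K k 𝔹 W U) (fderiv ℝ (msChart F N K k 𝔹 W U) 0) := by
  classical
  refine ⟨hasStrictFDerivAt_msChart_of_smooth hU hsm, ?_, eventually_agreeOn_of_msChart_eq_of_smooth h𝔹 hU hsm⟩
  refine LinearMap.range_eq_top.2 fun τ' => ?_
  let τ : (j : ℕ) → PBond (F.P K) j → lieSU (Fin N) := fun j c =>
    if h : j < k + 1 ∧ c ∈ bondsOf (𝔹 j) then τ' (constrEnum 𝔹 k ⟨⟨j, h.1⟩, c, h.2⟩) else 0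
  obtain ⟨X, hX⟩ := hH τ
  refine ⟨X, funext fun i => ?_⟩
  set s := (constrEnum 𝔹 k).symm i with hs
  have hj : (s.1 : ℕ) ≤ k := Nat.lt_succ_iff.1 s.1.2
  have hv := hX s.1 hj s.2.1 s.2.2
  have hτ : τ s.1 s.2.1 = τ' i := by
    show (if h : (s.1 : ℕ) < k + 1 ∧ (s.2.1 : PBond (F.P K) s.1) ∈ bondsOf (𝔹 s.1) then τ' (constrEnum 𝔹 k ⟨⟨s.1, h.1⟩, s.2.1, h.2⟩) else 0) = τ' i
    rw [dif_pos ⟨s.1.2, s.2.2⟩]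
    show τ' (constrEnum 𝔹 k s) = τ' i
    rw [hs, Equiv.apply_symm_apply]
  show fderiv ℝ (msChart F N K k 𝔹 W U) 0 X i = τ' i
  rw [fderiv_msChart_apply_of_hasDerivAt_of_smooth hU hsm X i hv, ← mul_assoc, star_coe_mul_coe_SU, one_mul, hτ, suProj_coe]

/-- ★★★ **CURVE-CRITICAL ⇒ TANGENT-CRITICAL ON A MULTI-SCALE FIBRE, LOCAL-SMOOTHNESS CURRENCY, MODULO [15] (45) AT `U`** — the form a TOP-DOMAIN consumer (stub 1's class:
small fields on `Ω₀ = Sup` only) can meet: no global guard, only `C¹`-ness at `X = 0` of the finitely many constrained outputs `X ↦ Ū^j(U·exp X)(c)`.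
[cite: Balaban1985Variational, (82)–(83) p.290, (141) p.299, p.300, Prop. 8 p.304, Sect. C (45)–(48) p.285; Balaban1988Convergent, (2.10)–(2.12) p.256] -/
theorem hasDerivAt_wilsonAction4_expChart_of_isCritOnFibre_of_smooth_of_rightInverse (h𝔹 : ∀ j, k < j → 𝔹 j = ∅)
    (hU : AgreeOn 𝔹 (avgFamily (avOfRecord F N K) U) W)
    (hsm : ∀ j, j ≤ k → ∀ c ∈ bondsOf (𝔹 j), ContDiffAt ℝ 1 (fun X : PBond (F.P K) 0 → lieSU (Fin N) =>
      ((avgFamily (avOfRecord F N K) (expChart U X) j c : SU N) : Matrix (Fin N) (Fin N) ℂ)) 0)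
    (hH : ∀ τ : (j : ℕ) → PBond (F.P K) j → lieSU (Fin N), ∃ X : PBond (F.P K) 0 → lieSU (Fin N), ∀ j, j ≤ k → ∀ c ∈ bondsOf (𝔹 j),
      HasDerivAt (fun t : ℝ => ((avgFamily (avOfRecord F N K) (expChart U (t • X)) j c : SU N) : Matrix (Fin N) (Fin N) ℂ))
        (((W j c : SU N) : Matrix (Fin N) (Fin N) ℂ) * ((τ j c : lieSU (Fin N)) : Matrix (Fin N) (Fin N) ℂ)) 0)
    (hcrit : IsCritOnFibre F N K 𝔹 W U) {X : PBond (F.P K) 0 → lieSU (Fin N)}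
    (hX : ∀ j, j ≤ k → ∀ c ∈ bondsOf (𝔹 j),
      HasDerivAt (fun t : ℝ => ((avgFamily (avOfRecord F N K) (expChart U (t • X)) j c : SU N) : Matrix (Fin N) (Fin N) ℂ)) 0 0) :
    HasDerivAt (fun t : ℝ => wilsonAction4 (expChart U (t • X))) 0 0 := by
  refine hasDerivAt_wilsonAction4_expChart_of_isCritOnFibre_near (isFibreChartNear_msChart_of_smooth h𝔹 hU hsm hH) hcrit ?_
  funext i
  set s := (constrEnum 𝔹 k).symm i with hs
  have hv := hX s.1 (Nat.lt_succ_iff.1 s.1.2) s.2.1 s.2.2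
  have h := fderiv_msChart_apply_of_hasDerivAt_of_smooth hU hsm X i hv
  rw [mul_zero, map_zero] at h
  exact h

end Local

end Literature.MathematicalPhysics.QuantumFieldTheory.Balaban1983to89.Node00

end
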